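import Summits.QuantumFields.BalabanUV.Beta.WardBorderReflectionContact

/-!
# `BalabanUV.Beta.WardBorderReflectionContactMirror` — binder row D1, (L4): «D1-hRhW-SOCKET-CONSISTENCY» part 2a′ — the MIRROR BLOCK
# `(x, inr m; z, inl β)`, `m ≠ α`, of part 2a's consistency identity for the canonical contact

HONEST FRAMING (cell charter, verbatim): «discharging BetaPertH makes Balaban's UV stability UNCONDITIONAL — a real
constructive-QFT result; it is NOT the continuum limit and NOT the Clay problem.»  Neutral [folklore] algebra, legs exchanged with respect to
`WardBorderReflectionContact.canonD_ward_eq_defect_inl_inr` (same hypotheses (H1)∕(H2) — (H2) now at the mirror entries — same scale relation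
`s·γ₀ = −½`; the face letter now sits on the SECOND leg `z` with the opposite sign).  No statement of Bałaban's papers, no `[cite:]`, no `def`;
instantiates NO binder of the β-function wall (0/4: hW, hR, D1Tel, D1Rep); NOT hW, NOT hR, NOT D1, NOT `BetaPertH`, NOT continuum, NOT Clay.
HONEST DEPENDENCY: continuum YM on T⁴ ⇐ BetaPertH ∧ nine spine estimates (0/9 proved); BetaPertH ⇐ (D1) ∧ (D4) ∧ CAP+tail;
G-an2-4 gates asym, D1 and NE2/3/4.

CONTENT (generic `d`, odd `Lc`, centred root): `divV_canonD_inr_inl` (per site), **`canonD_ward_eq_defect_inr_inl`** (the identity at `(x, inr m; z, inl β)`,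
`m ≠ α`).  With part 2a this settles the consistency identity `W_Y(B_α) = G_α` on ALL border entries whose multiplier leg is off the axis `α`;
the `inr α` legs are part 2b.
Provenance: β sub-cell, D1 formalisation swarm, unit b2b-balaban-beta-d1-formalise-leaf-04 gen 4, 2026-08-20 (v1); no existing file touched.
-/

open Finset
open scoped BigOperators
open Literature.MathematicalPhysics.QuantumFieldTheory
open Literature.MathematicalPhysics.QuantumFieldTheory.Balaban1983to89
open Literature.MathematicalPhysics.QuantumFieldTheory.Balaban1983to89.Beta
open ExpKernelCalculus (MKer)
open AffineAveraging (box toSite)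
open AveragingContoursRooted (ctrOff)
open KernelWard (divV)
open PolarizationSign (reflSign)
open KernelReflection (LegMap refK refK_apply)
open ResolventReflection (sref sref_sref bref mref Φ Φ_r_inl Φ_r_inr Φ_s_inl Φ_s_inr)
open OneStepResolventKernel (Fib)
open Summit.QuantumFields.BalabanUV.Beta.TameKernelCalculus
open Summit.QuantumFields.BalabanUV.Beta.ChartConjugation (conjV)
open Summit.QuantumFields.BalabanUV.Beta.BorderedHessian (diagK diagK_apply conjV_diagK_apply ctGen ctGen_inl ctGen_inr)
open Summit.QuantumFields.BalabanUV.Beta.AveragingWardRootedStencils (legSite legInd legInd_inl legInd_inr)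
open Summit.QuantumFields.BalabanUV.Beta.SecondOrderBorderGauge (actS actS_apply canonD canonD_apply)
open Summit.QuantumFields.BalabanUV.Beta.WardBorderReflectionContact (sref_bref_of_ne sref_bref_self mref_add_ctr blockInd_sref dSym_inl dSym_inr
  ctGen_inr_of_ne sum_fieldLetter_div)

namespace Summit.QuantumFields.BalabanUV.Beta.WardBorderReflectionContactMirror

noncomputable section

variable {d : ℕ} (Lc : ℕ) (α : Fin (d + 1)) (γ₀ s : ℝ) (𝕄 : MKer (d + 1) (Fib d))
  (S : Fin (d + 1) → (Fin (d + 1) → ℤ) → MKer (d + 1) (Fib d))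

/-- [folklore] **THE DIVERGENCE OF THE CANONICAL CONTACT AT ONE SITE**, mirror entry `(x, inr m; z, inl β)`, `m ≠ α`:
`Σ_κ (D κ (y−e_κ) κ′ u′ − D κ y κ′ u′)(e′) = −γ₀·S κ′u′(e′)·FL(y) − γ₀·c″·(divV S y)(e′) + γ₀²·c″·𝕄(e′)·FL(y)`, face letter on the second leg
`FL(y) = [β = α]·([z + e_α = y] − [z = y])`, second bond's letter `c″ = [z = u′ ∧ β = κ′ ∧ κ′ = α]`. -/
theorem divV_canonD_inr_inl {m : Fin (d + 1)} (hm : m ≠ α) (κ' : Fin (d + 1)) (u' y x z : Fin (d + 1) → ℤ) (β : Fin (d + 1)) :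
    divV (fun κ u => canonD 𝕄 S (fun κ u p c => γ₀ * ctGen d α Lc κ u p c) κ u κ' u') y x z (Sum.inr m) (Sum.inl β) =
      -(γ₀ * S κ' u' x z (Sum.inr m) (Sum.inl β) *
          (if β = α then ((if z + B6BondElimination.unitVec α = y then (1 : ℝ) else 0) - (if z = y then 1 else 0)) else 0)) -
        γ₀ * (if z = u' ∧ β = κ' ∧ κ' = α then (1 : ℝ) else 0) * divV S y x z (Sum.inr m) (Sum.inl β) +
        γ₀ ^ 2 * (if z = u' ∧ β = κ' ∧ κ' = α then (1 : ℝ) else 0) * 𝕄 x z (Sum.inr m) (Sum.inl β) *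
          (if β = α then ((if z + B6BondElimination.unitVec α = y then (1 : ℝ) else 0) - (if z = y then 1 else 0)) else 0) := by
  have hcst : ∀ u : Fin (d + 1) → ℤ, ∀ κ : Fin (d + 1),
      (γ₀ * ctGen d α Lc κ u z (Sum.inl β) - γ₀ * ctGen d α Lc κ u x (Sum.inr m)) =
        -(γ₀ * (if z = u ∧ β = κ ∧ κ = α then (1 : ℝ) else 0)) := by
    intro u κ
    rw [ctGen_inr_of_ne α Lc hm, ctGen_inl]
    split_ifs <;> ring
  have e : ∀ κ : Fin (d + 1), ∀ u : Fin (d + 1) → ℤ,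
      canonD 𝕄 S (fun κ u p c => γ₀ * ctGen d α Lc κ u p c) κ u κ' u' x z (Sum.inr m) (Sum.inl β) =
        -(γ₀ * S κ' u' x z (Sum.inr m) (Sum.inl β) * (if z = u ∧ β = κ ∧ κ = α then (1 : ℝ) else 0)) -
          γ₀ * (if z = u' ∧ β = κ' ∧ κ' = α then (1 : ℝ) else 0) * S κ u x z (Sum.inr m) (Sum.inl β) +
          γ₀ ^ 2 * (if z = u' ∧ β = κ' ∧ κ' = α then (1 : ℝ) else 0) * 𝕄 x z (Sum.inr m) (Sum.inl β) *
            (if z = u ∧ β = κ ∧ κ = α then (1 : ℝ) else 0) := by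
    intro κ u
    rw [canonD_apply, hcst, hcst]
    ring
  simp only [KernelWard.divV, Finset.sum_apply, Pi.sub_apply, e]
  rw [← sum_fieldLetter_div α z y β, Finset.mul_sum, Finset.mul_sum, Finset.mul_sum, ← Finset.sum_neg_distrib, ← Finset.sum_sub_distrib,
    ← Finset.sum_add_distrib]
  refine Finset.sum_congr rfl fun κ _ => ?_
  ring

/-- [folklore] **THE CONSISTENCY IDENTITY AT THE MIRROR ENTRIES `(x, inr m; z, inl β)`, `m ≠ α`** (hypotheses as in part 2a, (H2) at the mirror
entries): `(s • Σ_v divV (κ u ↦ canonD 𝕄 S (γ₀ĉt^α) κ u κ′ u′) (Lc•Y+v)) (e′) = (ε_α(κ′) • refK_α (conjV (S κ′ (bref α κ′ u′)) D_{sref α Y}) − conjV (S κ′ u′) D_Y) (e′)`. -/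
theorem canonD_ward_eq_defect_inr_inl (hLc : Odd Lc) {m : Fin (d + 1)} (hm : m ≠ α) (hs : s * γ₀ = -(1 / 2 : ℝ))
    (hlaw : actS Lc α S = fun κ u => S κ u + conjV 𝕄 (diagK fun p c => γ₀ * ctGen d α Lc κ u p c))
    (hward : ∀ (Y x z : Fin (d + 1) → ℤ) (β : Fin (d + 1)),
      (∑ v ∈ box (d + 1) Lc, divV S ((Lc : ℤ) • Y + toSite v)) x z (Sum.inr m) (Sum.inl β) =
        ((-2 * γ₀) • conjV 𝕄 (diagK ((1 / 2 : ℝ) • ∑ v ∈ box (d + 1) Lc,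
          legInd (toSite (ctrOff (d + 1) Lc)) ((Lc : ℤ) • Y + toSite v)))) x z (Sum.inr m) (Sum.inl β))
    (Y : Fin (d + 1) → ℤ) (κ' : Fin (d + 1)) (u' x z : Fin (d + 1) → ℤ) (β : Fin (d + 1)) :
    (s • ∑ v ∈ box (d + 1) Lc, divV (fun κ u => canonD 𝕄 S (fun κ u p c => γ₀ * ctGen d α Lc κ u p c) κ u κ' u')
        ((Lc : ℤ) • Y + toSite v)) x z (Sum.inr m) (Sum.inl β) =
      (reflSign α κ' • refK (Φ (d := d) Lc α) (conjV (S κ' (bref α κ' u'))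
          (diagK ((1 / 2 : ℝ) • ∑ v ∈ box (d + 1) Lc, legInd (toSite (ctrOff (d + 1) Lc)) ((Lc : ℤ) • sref α Y + toSite v)))) -
        conjV (S κ' u') (diagK ((1 / 2 : ℝ) • ∑ v ∈ box (d + 1) Lc, legInd (toSite (ctrOff (d + 1) Lc)) ((Lc : ℤ) • Y + toSite v))))
        x z (Sum.inr m) (Sum.inl β) := by
  set ρ : Fin (d + 1) → ℤ := toSite (ctrOff (d + 1) Lc) with hρ
  set A : ℝ := S κ' u' x z (Sum.inr m) (Sum.inl β) with hA
  set M : ℝ := 𝕄 x z (Sum.inr m) (Sum.inl β) with hM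
  set Nz : ℝ := ∑ v ∈ box (d + 1) Lc, (if z = (Lc : ℤ) • Y + toSite v then (1 : ℝ) else 0) with hNz
  set Nze : ℝ := ∑ v ∈ box (d + 1) Lc, (if z + B6BondElimination.unitVec α = (Lc : ℤ) • Y + toSite v then (1 : ℝ) else 0) with hNze
  set Nx : ℝ := ∑ v ∈ box (d + 1) Lc, (if x + ρ = (Lc : ℤ) • Y + toSite v then (1 : ℝ) else 0) with hNx
  have hcst : ∀ u : Fin (d + 1) → ℤ, ∀ κ : Fin (d + 1),
      (γ₀ * ctGen d α Lc κ u z (Sum.inl β) - γ₀ * ctGen d α Lc κ u x (Sum.inr m)) =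
        -(γ₀ * (if z = u ∧ β = κ ∧ κ = α then (1 : ℝ) else 0)) := by
    intro u κ
    rw [ctGen_inr_of_ne α Lc hm, ctGen_inl]
    split_ifs <;> ring
  -- (H1) at this entry
  have hlaw_e : reflSign α κ' * (reflSign α m * reflSign α β *
      S κ' (bref α κ' u') (mref Lc α m x) (bref α β z) (Sum.inr m) (Sum.inl β)) =
        A + M * -(γ₀ * (if z = u' ∧ β = κ' ∧ κ' = α then (1 : ℝ) else 0)) := by
    have e := congrFun (congrFun (congrFun (congrFun (congrFun (congrFun hlaw κ') u') x) z) (Sum.inr m)) (Sum.inl β)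
    rw [actS_apply, Φ_s_inl, Φ_s_inr, Φ_r_inl, Φ_r_inr] at e
    rw [e, Pi.add_apply, Pi.add_apply, Pi.add_apply, Pi.add_apply, conjV_diagK_apply, hcst]
  -- the reflected symbols of `D`
  have hDx : ((1 / 2 : ℝ) • ∑ v ∈ box (d + 1) Lc, legInd ρ ((Lc : ℤ) • sref α Y + toSite v)) (mref Lc α m x) (Sum.inr m) =
      (1 / 2 : ℝ) * Nx := by
    rw [dSym_inr, mref_add_ctr α hLc hm, blockInd_sref, sref_sref]
  have hDz : ((1 / 2 : ℝ) • ∑ v ∈ box (d + 1) Lc, legInd ρ ((Lc : ℤ) • sref α Y + toSite v)) (bref α β z) (Sum.inl β) =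
      (1 / 2 : ℝ) * (if β = α then Nze else Nz) := by
    rw [dSym_inl, blockInd_sref]
    by_cases hβ : β = α
    · subst hβ; rw [if_pos rfl, sref_bref_self]
    · rw [if_neg hβ, sref_bref_of_ne α hβ]
  have hDx0 : ((1 / 2 : ℝ) • ∑ v ∈ box (d + 1) Lc, legInd ρ ((Lc : ℤ) • Y + toSite v)) x (Sum.inr m) = (1 / 2 : ℝ) * Nx :=
    dSym_inr Lc ρ Y x m
  have hDz0 : ((1 / 2 : ℝ) • ∑ v ∈ box (d + 1) Lc, legInd ρ ((Lc : ℤ) • Y + toSite v)) z (Sum.inl β) = (1 / 2 : ℝ) * Nz :=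
    dSym_inl Lc ρ Y z β
  -- (H2) at this entry
  have hward_e : (∑ v ∈ box (d + 1) Lc, divV S ((Lc : ℤ) • Y + toSite v)) x z (Sum.inr m) (Sum.inl β) =
      (-2 * γ₀) * (M * ((1 / 2 : ℝ) * Nz - (1 / 2 : ℝ) * Nx)) := by
    rw [hward, Pi.smul_apply, Pi.smul_apply, Pi.smul_apply, Pi.smul_apply, smul_eq_mul, conjV_diagK_apply, hDz0, hDx0]
  -- LHS
  have hL : (∑ v ∈ box (d + 1) Lc, divV (fun κ u => canonD 𝕄 S (fun κ u p c => γ₀ * ctGen d α Lc κ u p c) κ u κ' u')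
      ((Lc : ℤ) • Y + toSite v)) x z (Sum.inr m) (Sum.inl β) =
      -(γ₀ * A * (if β = α then Nze - Nz else 0)) -
        γ₀ * (if z = u' ∧ β = κ' ∧ κ' = α then (1 : ℝ) else 0) *
          ((∑ v ∈ box (d + 1) Lc, divV S ((Lc : ℤ) • Y + toSite v)) x z (Sum.inr m) (Sum.inl β)) +
        γ₀ ^ 2 * (if z = u' ∧ β = κ' ∧ κ' = α then (1 : ℝ) else 0) * M * (if β = α then Nze - Nz else 0) := by
    simp only [Finset.sum_apply, divV_canonD_inr_inl Lc α γ₀ 𝕄 S hm, ← hA, ← hM]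
    rw [Finset.sum_add_distrib, Finset.sum_sub_distrib, Finset.sum_neg_distrib, ← Finset.mul_sum, ← Finset.mul_sum, ← Finset.mul_sum]
    have hFL : ∑ v ∈ box (d + 1) Lc,
        (if β = α then ((if z + B6BondElimination.unitVec α = (Lc : ℤ) • Y + toSite v then (1 : ℝ) else 0) -
          (if z = (Lc : ℤ) • Y + toSite v then 1 else 0)) else 0) = if β = α then Nze - Nz else 0 := by
      by_cases hβ : β = α
      · simp only [if_pos hβ, Finset.sum_sub_distrib, hNze, hNz]
      · simp only [if_neg hβ, Finset.sum_const_zero]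
    rw [hFL]
  -- assemble
  have hγ : γ₀ ≠ 0 := by
    rintro rfl; norm_num at hs
  have hs' : s = -(1 / 2 : ℝ) / γ₀ := by
    field_simp; linarith [hs]
  rw [Pi.smul_apply, Pi.smul_apply, Pi.smul_apply, Pi.smul_apply, smul_eq_mul, hL, hward_e]
  rw [Pi.sub_apply, Pi.sub_apply, Pi.sub_apply, Pi.sub_apply, Pi.smul_apply, Pi.smul_apply, Pi.smul_apply, Pi.smul_apply,
    smul_eq_mul, refK_apply, Φ_s_inl, Φ_s_inr, Φ_r_inl, Φ_r_inr, conjV_diagK_apply, conjV_diagK_apply, hDz, hDx, hDz0, hDx0,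
    ← hA]
  rw [show reflSign α κ' * (reflSign α m * reflSign α β *
      (S κ' (bref α κ' u') (mref Lc α m x) (bref α β z) (Sum.inr m) (Sum.inl β) * ((1 / 2 : ℝ) * (if β = α then Nze else Nz) - (1 / 2 : ℝ) * Nx))) =
      (reflSign α κ' * (reflSign α m * reflSign α β * S κ' (bref α κ' u') (mref Lc α m x) (bref α β z) (Sum.inr m) (Sum.inl β))) *
        ((1 / 2 : ℝ) * (if β = α then Nze else Nz) - (1 / 2 : ℝ) * Nx) by ring, hlaw_e, hs']
  by_cases hβ : β = α
  · simp only [if_pos hβ]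
    field_simp
    ring
  · have hc : ¬(z = u' ∧ β = κ' ∧ κ' = α) := fun h => hβ (h.2.1.trans h.2.2)
    simp only [if_neg hβ, if_neg hc]
    ring

end

end Summit.QuantumFields.BalabanUV.Beta.WardBorderReflectionContactMirror
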